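import Literature.Barriers.CriticalPhenomena.PositionSpaceRGNonGibbsianTorusContours
import Literature.Barriers.CriticalPhenomena.PositionSpaceRGNonGibbsianThm43Reduction
import Literature.Barriers.CriticalPhenomena.PositionSpaceRGNonGibbsianThm43Screening
import Literature.Probability.LatticeModels.IsingUnfixing
import Literature.Probability.LatticeModels.IsingVolumeMonotonicity
import Literature.Probability.LatticeModels.IsingMonotonicity
import HarnessLib

/-!
# The `+` phase of the internal spins for `b ≥ 3`, and Theorem 4.3 of van Enter–Fernández–Sokal

Final file of the Theorem 4.3 line of the barrier
`Literature/Barriers/CriticalPhenomena/PositionSpaceRGNonGibbsian.lean` (van Enter–Fernández–Sokal,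
J. Stat. Phys. **72** (1993) 879, arXiv:hep-lat/9210032). The tree reduced `VEFS1993_thm43` to the
`b ≥ 3` half of the plus-phase bound `VEFS1993_plusPhase` (`VEFS1993_thm43_of_plusPhase_three_le`,
`…Thm43Reduction.lean`): for `d ≥ 2`, `b ≥ 3` and `β > J₂(d,b)` the systems
`(spacingVolume d b R', β, 0, η_p)`, `η_p = signedCoreAnnulusBC d b p R' R' 1 1` (image spins of the
cube `Λ_{R'}` frozen to `p·ω'_alt`, `+` spins outside, the origin NOT frozen), satisfy `⟨σ₀⟩ ≥ c > 0`
uniformly in `R'` and `p`. The source obtains this from "a slight generalisation" of Pirogov–Sinai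
theory (§4.3.2, App. B.5.3); this line of files replaces that input by reflection positivity and a
chessboard–Peierls argument on the alt-pinned torus (`…PinnedTorus.lean`, `…TorusPeierls.lean`,
`…TorusContours.lean`) together with the cluster-flip Peierls bound near the origin proved here.

## The argument (`plusPhase_three_le_rp`, an independent second proof of the `b ≥ 3` plus phase; the
tree's discharge `VEFS1993_thm43_holds` of `…Thm43Holds.lean` uses the twisted-Peierls bound
`SpacingPeierls.plusPhase_three_le` of `…PlusPhaseProofs.lean` instead)

1. **Unfixing the origin** (`spinAt_zero_ge_unfix`, §4.1.2 Step 3 eqs. (4.10)–(4.11)): for `R' ≥ 1`,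
   `⟨σ₀⟩^{η_p}_{W(R')} ≥ (1 - X)/(1 + X)` with `X = ⟨exp(-2β S₀)⟩^{η_p}_{Λ^int_{R'}}`, `S₀` the sum of the
   `2d` neighbouring spins (`isingExpect_spinAt_insert_eq`; for `p = -1` the boundary spin at the origin
   is first raised to `+1`, which is harmless for `W(R') ∋ 0` and lowers `X` by FKG).
2. **Near/far decomposition** (`exp_nbrSum_le`, `isingExpect_exp_nbrSum_le`): with `K` the union of
   the `-` clusters (inside `Λ^int`) of the `-` neighbours of `0` and `k` the number of such neighbours,
   `exp(-2βS₀) = e^{4β(k-d)}`; either `K` reaches sup-distance `> m` (the far event `FarEvent` of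
   `…TorusContours.lean`, costing at most `e^{4dβ}`), or `K = κ ⊆ box m`, an island of `-` spins with
   `+` internal neighbours (`isIsland_negClus`), whose probability is at most `exp(-β |∂κ|_ff)` by the
   flip of `κ` (`isingExpect_islandInd_le`: the energy drops by `2(|∂κ|_ff + ∑_κ h) ≥ |∂κ|_ff`, the
   Peierls condition `sum_imgField_ge` of `…PeierlsCondition.lean`, App. B.5.3 (B.71)–(B.77)).
3. **Isoperimetry near the origin** (`card_ffBdryPairs_ge_of_petals`, `b ≥ 3`): a set containing `k ≥ 1`
   neighbours of `0` has `|∂κ|_ff ≥ 2k(d-1) + 1` (both ends of the `d-1` image-free lateral lines through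
   each of them, `latPair_injOn`, plus one axial or height-`2` pair, `extraPair_not_mem_image`), so
   every island term is `≤ e^{-β}` (`near_exponent_le`) and the near part is `≤ 2^{#box m} e^{-β}`.
4. **Far part** (`isingExpect_farInd_le_pow`): `P(FarEvent) ≤ 15 (27^d ε_blk)^{m'+1}`,
   `ε_blk = 2^d 2^{b^d} e^{-β/4^d}`, `m = b(m'+2)`, by the chessboard–Peierls bound transferred to the
   box (`isingExpect_farInd_le` of `…TorusContours.lean`, torus side `N = 2^{2R'+2m'+5}`).
5. **Thresholds** (`eventually_conditions`, `far_term_eq`): with `m' + 1 = 4^d (4d+1)` the far term is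
   `C(d,b) e^{-β}`, and all smallness conditions hold for `β` large; then `X ≤ 1/3` and `⟨σ₀⟩ ≥ 1/2`.
   The case `R' = 0` follows by monotonicity in the volume and in the boundary condition
   (`spinAt_zero_spacingVolume_one_le_zero`).

The closing `example` re-derives `VEFS1993_thm43` from `plusPhase_three_le_rp` and the reduction
`VEFS1993_thm43_of_plusPhase_three_le`. Nothing is asserted: the file is sorry-free and introduces no
named fact (D-0014, D-0026).

## References

* A. C. D. van Enter, R. Fernández, A. D. Sokal, J. Stat. Phys. 72 (1993) 879–1167,
  arXiv:hep-lat/9210032 — Theorem 4.3, §4.1.2 Step 3, §4.3.1 Step 2, §4.3.2, App. B.5.3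
  [VanenterFernandezSokal1993].
* S. Friedli, Y. Velenik, *Statistical Mechanics of Lattice Systems*, CUP 2017, Lemma 3.36 (Peierls
  flips), Lemma 3.22 / Exercise 3.13 (volume monotonicity), §10.4.2 (chessboard estimates)
  [FriedliVelenik2017].
-/

noncomputable section

namespace Literature.Barriers.CriticalPhenomena.NonGibbs

open Finset Relation Literature.Probability.LatticeModels

variable {d : ℕ}

/-! ### The volumes and the boundary condition -/

section Volumes

variable {b : ℕ}

/-- `W(R') = {0} ∪ Λ^int_{R'}`: the volume of the systems of `VEFS1993_plusPhase` is the internal volume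
together with the (unfrozen) origin. [cite: VanenterFernandezSokal1993, §4.1.2 Step 3 and §4.2 Step 2] -/
theorem spacingVolume_eq_insert (b R' : ℕ) :
    spacingVolume d b R' = insert 0 (spacingIntVolume d b R') := by
  ext y
  rw [mem_insert, spacingVolume, mem_filter, mem_spacingIntVolume]
  constructor
  · rintro ⟨hbox, h0 | hint⟩
    · exact Or.inl h0
    · exact Or.inr ⟨hbox, hint⟩
  · rintro (rfl | ⟨hbox, hint⟩)
    · exact ⟨zero_mem_box d _, Or.inl rfl⟩
    · exact ⟨hbox, Or.inr hint⟩

/-- Off the origin, the boundary condition with empty core is `+1`. [cite: VanenterFernandezSokal1993, §4.2 Step 2] -/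
theorem signedCoreAnnulusBC_zero_zero_of_ne (hb : 0 < b) (p : ℤˣ) {y : Site d} (hy : y ≠ 0) :
    signedCoreAnnulusBC d b p 0 0 1 1 y = 1 := by
  unfold signedCoreAnnulusBC
  have hbox0 : ∀ x : Site d, x ∈ box d 0 → x = 0 := fun x hx => by
    funext i; have := (mem_box.1 hx) i; simp only [Nat.cast_zero, neg_zero] at this
    exact le_antisymm this.2 this.1
  by_cases himg : ∀ i, (b : ℤ) ∣ y i
  · have hq : (fun i => y i / b) ∉ box d 0 := by
      intro hq
      apply hy
      funext i
      have h1 := congrFun (hbox0 _ hq) i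
      simp only [Pi.zero_apply] at h1 ⊢
      obtain ⟨c, hc⟩ := himg i
      have hb' : (b : ℤ) ≠ 0 := by exact_mod_cast hb.ne'
      rw [hc, Int.mul_ediv_cancel_left _ hb'] at h1
      rw [hc, h1, mul_zero]
    simp [himg, hq]
  · simp [himg]

end Volumes

/-! ### Minus islands and the flip bound -/

section Island

variable {b : ℕ}

/-- **The island event** `E_κ`: the spins of `κ` are `-` and the spins of `Λ ∖ κ` adjacent to `κ`
are `+` (the event "the `-` cluster structure near the origin is exactly `κ`" implies it).
[cite: FriedliVelenik2017, Lemma 3.36] -/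
def IsIsland (Λ κ : Finset (Site d)) (σ : SpinConfig (Site d)) : Prop :=
  (∀ x ∈ κ, σ x = -1) ∧ ∀ z ∈ Λ, z ∉ κ → (∃ y ∈ κ, (zdGraph d).Adj y z) → σ z = 1

/-- The indicator of the island event. [cite: FriedliVelenik2017, Lemma 3.36] -/
def islandInd (Λ κ : Finset (Site d)) (σ : SpinConfig (Site d)) : ℝ :=
  open Classical in if IsIsland Λ κ σ then 1 else 0

/-- `islandInd ≥ 0`. [folklore] -/
theorem islandInd_nonneg (Λ κ : Finset (Site d)) (σ : SpinConfig (Site d)) : 0 ≤ islandInd Λ κ σ := by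
  unfold islandInd; split_ifs <;> norm_num

/-- The island event depends only on the spins in `Λ` (for `κ ⊆ Λ`). [folklore] -/
theorem islandInd_congr {Λ κ : Finset (Site d)} (hκ : κ ⊆ Λ) {σ σ' : SpinConfig (Site d)}
    (h : ∀ x ∈ Λ, σ x = σ' x) : islandInd Λ κ σ = islandInd Λ κ σ' := by
  have hiff : IsIsland Λ κ σ ↔ IsIsland Λ κ σ' := by
    unfold IsIsland
    constructor
    · rintro ⟨h1, h2⟩
      exact ⟨fun x hx => by rw [← h x (hκ hx)]; exact h1 x hx,
        fun z hz hzκ hex => by rw [← h z hz]; exact h2 z hz hzκ hex⟩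
    · rintro ⟨h1, h2⟩
      exact ⟨fun x hx => by rw [h x (hκ hx)]; exact h1 x hx,
        fun z hz hzκ hex => by rw [h z hz]; exact h2 z hz hzκ hex⟩
  unfold islandInd
  by_cases h1 : IsIsland Λ κ σ
  · rw [if_pos h1, if_pos (hiff.1 h1)]
  · rw [if_neg h1, if_neg (mt hiff.2 h1)]

/-- **The boundary field of an island site** (on `E_κ`, boundary spins `η` with `η = +1` at the
internal sites off `Λ`, `Λ` and hence `κ` internal): `∑_{z ∼ y, z ∉ κ} σ_z = #{internal such z} + h_y`.
[cite: VanenterFernandezSokal1993, App. B.5.3 eq. (B.71)] -/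
theorem sum_outNbrs_spinAt_of_isIsland {Λ κ : Finset (Site d)} (hκΛ : κ ⊆ Λ)
    (hΛ : ∀ u ∈ Λ, ¬ IsSpImageSite d b u) {η σ : SpinConfig (Site d)} (hση : ∀ z, z ∉ Λ → σ z = η z)
    (hη1 : ∀ z, z ∉ Λ → ¬ IsSpImageSite d b z → η z = 1) (hI : IsIsland Λ κ σ) {y : Site d} (hy : y ∈ κ) :
    ∑ z ∈ outNbrs (zdGraph d) κ y, spinAt z σ =
      #((outNbrs (zdGraph d) κ y).filter fun z => ¬ IsSpImageSite d b z) + imgField d b η y := by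
  classical
  rw [← sum_filter_add_sum_filter_not (outNbrs (zdGraph d) κ y) (fun z => ¬ IsSpImageSite d b z)]
  congr 1
  · rw [card_eq_sum_ones, Nat.cast_sum, Nat.cast_one]
    refine sum_congr rfl fun z hz => ?_
    obtain ⟨hz, hzimg⟩ := mem_filter.1 hz
    obtain ⟨hadj, hzκ⟩ := (mem_outNbrs (zdGraph d)).1 hz
    by_cases hzΛ : z ∈ Λ
    · simp [spinAt, hI.2 z hzΛ hzκ ⟨y, hy, hadj⟩]
    · simp [spinAt, hση z hzΛ, hη1 z hzΛ hzimg]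
  · unfold imgField
    have hset : (outNbrs (zdGraph d) κ y).filter (fun z => ¬¬ IsSpImageSite d b z) = imgNbrs d b y := by
      ext z
      simp only [mem_filter, mem_outNbrs, not_not, mem_imgNbrs]
      constructor
      · rintro ⟨⟨hadj, -⟩, himg⟩; exact ⟨hadj, himg⟩
      · rintro ⟨hadj, himg⟩; exact ⟨⟨hadj, fun hzκ => hΛ z (hκΛ hzκ) himg⟩, himg⟩
    rw [hset]
    refine sum_congr rfl fun z hz => ?_
    have himg := (mem_imgNbrs.1 hz).2
    have hzΛ : z ∉ Λ := fun h => hΛ z h himg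
    simp [spinAt, hση z hzΛ]

/-- **The energy released by flipping an island** (zero field, boundary spins as above): on `E_κ`,
`H^η_Λ(σ) - H^η_Λ(σ^κ) = 2(|∂κ|_ff + ∑_{y ∈ κ} h_y)` — all the bonds from `κ` to internal sites are
frustrated, the bonds to image sites carry the field `h_y`. [cite: VanenterFernandezSokal1993, App. B.5.3 eq. (B.71)] -/
theorem isingHamiltonian_sub_flipOn_of_isIsland {Λ κ : Finset (Site d)} (hκΛ : κ ⊆ Λ)
    (hΛ : ∀ u ∈ Λ, ¬ IsSpImageSite d b u) {η σ : SpinConfig (Site d)} (hση : ∀ z, z ∉ Λ → σ z = η z)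
    (hη1 : ∀ z, z ∉ Λ → ¬ IsSpImageSite d b z → η z = 1) (hI : IsIsland Λ κ σ) :
    isingHamiltonian (zdGraph d) Λ 0 (.fixed η) σ - isingHamiltonian (zdGraph d) Λ 0 (.fixed η) (flipOn κ σ) =
      2 * (#(ffBdryPairs d b κ) + ∑ y ∈ κ, imgField d b η y) := by
  classical
  have hflip := isingHamiltonian_sub_isingHamiltonian_flipOn (zdGraph d) hκΛ 0 η σ
  rw [sum_edgeBoundary_bondSpin] at hflip
  have hinner : ∑ y ∈ κ, spinAt y σ * ∑ z ∈ outNbrs (zdGraph d) κ y, spinAt z σ =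
      -(#(ffBdryPairs d b κ) + ∑ y ∈ κ, imgField d b η y) := by
    rw [card_ffBdryPairs_eq_sum, Nat.cast_sum, ← sum_add_distrib, ← sum_neg_distrib]
    refine sum_congr rfl fun y hy => ?_
    rw [sum_outNbrs_spinAt_of_isIsland hκΛ hΛ hση hη1 hI hy]
    simp [spinAt, hI.1 y hy]
  rw [hinner] at hflip
  linarith

/-- **The flip bound for islands** (Peierls): for `β ≥ 0`, frozen spins `η` with isolated `-` spins
and `+1` at the internal sites off the internal volume `Λ`, and `κ ⊆ Λ`,
`P^η_Λ(E_κ) ≤ exp(-β |∂κ|_ff)` — flip `κ`: the energy drops by `2(|∂κ|_ff + ∑ h) ≥ |∂κ|_ff`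
(`sum_imgField_ge`, the Peierls condition of App. B.5.3) and the flip is injective.
[cite: FriedliVelenik2017, Lemma 3.36] [cite: VanenterFernandezSokal1993, App. B.5.3 eqs. (B.71)–(B.77)] -/
theorem isingExpect_islandInd_le (hd : 2 ≤ d) (hb : 2 ≤ b) {Λ κ : Finset (Site d)} (hκΛ : κ ⊆ Λ)
    (hΛ : ∀ u ∈ Λ, ¬ IsSpImageSite d b u) {η : SpinConfig (Site d)} (hηiso : MinusIsolated d b η)
    (hη1 : ∀ z, z ∉ Λ → ¬ IsSpImageSite d b z → η z = 1) {β : ℝ} (hβ : 0 ≤ β) :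
    isingExpect (zdGraph d) Λ β 0 (.fixed η) (islandInd Λ κ) ≤ Real.exp (-(β * #(ffBdryPairs d b κ))) := by
  classical
  have hm : Measurable (islandInd (d := d) Λ κ) :=
    DependsOn.measurable_of_finset Λ fun σ σ' h => islandInd_congr hκΛ h
  rw [isingExpect_eq_sum_div (zdGraph d) Λ 0 _ β hm]
  have hZ := isingPartitionFunction_pos (zdGraph d) Λ β 0 (.fixed η)
  rw [div_le_iff₀ hZ]
  set w := isingWeight (zdGraph d) Λ β 0 (.fixed η) with hw
  set E : Finset (Λ → ℤˣ) := univ.filter fun τ => IsIsland Λ κ (glue Λ τ (.fixed η)) with hE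
  -- the numerator is the weight of the event
  have hnum : ∑ τ, w τ * islandInd Λ κ (glue Λ τ (.fixed η)) = ∑ τ ∈ E, w τ := by
    rw [hE, sum_filter]
    refine sum_congr rfl fun τ _ => ?_
    unfold islandInd
    split_ifs <;> simp
  rw [hnum]
  -- on the event, `w τ ≤ exp(-β |∂κ|) w(flip τ)`
  have hexc : (#(ffBdryPairs d b κ) : ℝ) ≤ 2 * (#(ffBdryPairs d b κ) + ∑ y ∈ κ, imgField d b η y) := by
    have := sum_imgField_ge hd hb hηiso κ
    linarith
  have hle : ∀ τ ∈ E, w τ ≤ Real.exp (-(β * #(ffBdryPairs d b κ))) * w (flipOnFin Λ κ τ) := by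
    intro τ hτ
    have hI := (mem_filter.1 hτ).2
    have hση : ∀ z, z ∉ Λ → glue Λ τ (.fixed η) z = η z := fun z hz => glue_apply_of_notMem Λ τ _ hz
    have hen := isingHamiltonian_sub_flipOn_of_isIsland hκΛ hΛ hση hη1 hI
    rw [hw, isingWeight, isingWeight, glue_flipOnFin hκΛ, ← Real.exp_add]
    apply Real.exp_le_exp.2
    nlinarith
  calc ∑ τ ∈ E, w τ ≤ ∑ τ ∈ E, Real.exp (-(β * #(ffBdryPairs d b κ))) * w (flipOnFin Λ κ τ) := sum_le_sum hle
    _ = Real.exp (-(β * #(ffBdryPairs d b κ))) * ∑ τ ∈ E, w (flipOnFin Λ κ τ) := by rw [mul_sum]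
    _ ≤ Real.exp (-(β * #(ffBdryPairs d b κ))) * isingPartitionFunction (zdGraph d) Λ β 0 (.fixed η) := by
        gcongr
        rw [← sum_image (f := w) fun τ _ τ' _ h => flipOnFin_injective Λ κ h]
        exact sum_le_sum_of_subset_of_nonneg (subset_univ _) fun τ _ _ => (isingWeight_pos _ _ _ _ _ τ).le

end Island

/-! ### Boundary pairs of a set containing petals of the origin: lateral lines -/

section Lateral

variable {b : ℕ}

/-- The values `t` with `u[i ↦ t] ∈ κ`: the trace of `κ` on the lattice line through `u` in the
direction `i`. [folklore] -/
def lineVals (κ : Finset (Site d)) (u : Site d) (i : Fin d) : Finset ℤ :=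
  (κ.filter fun y => ∀ j, j ≠ i → y j = u j).image fun y => y i

/-- Membership in `lineVals`. [folklore] -/
theorem mem_lineVals {κ : Finset (Site d)} {u : Site d} {i : Fin d} {t : ℤ} :
    t ∈ lineVals κ u i ↔ Function.update u i t ∈ κ := by
  rw [lineVals, mem_image]
  constructor
  · rintro ⟨y, hy, rfl⟩
    obtain ⟨hyκ, hline⟩ := mem_filter.1 hy
    convert hyκ
    funext j
    by_cases hj : j = i
    · subst hj; simp
    · rw [Function.update_of_ne hj]; exact (hline j hj).symm
  · intro h
    exact ⟨Function.update u i t, mem_filter.2 ⟨h, fun j hj => by rw [Function.update_of_ne hj]⟩, by simp⟩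

/-- The line through a point of `κ` meets `κ`. [folklore] -/
theorem lineVals_nonempty {κ : Finset (Site d)} {u : Site d} (hu : u ∈ κ) (i : Fin d) :
    (lineVals κ u i).Nonempty :=
  ⟨u i, mem_lineVals.2 (by rw [Function.update_eq_self]; exact hu)⟩

/-- The largest `t` with `u[i ↦ t] ∈ κ` (or `0`). [folklore] -/
def topT (κ : Finset (Site d)) (u : Site d) (i : Fin d) : ℤ :=
  if h : (lineVals κ u i).Nonempty then (lineVals κ u i).max' h else 0

/-- The least `t` with `u[i ↦ t] ∈ κ` (or `0`). [folklore] -/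
def botT (κ : Finset (Site d)) (u : Site d) (i : Fin d) : ℤ :=
  if h : (lineVals κ u i).Nonempty then (lineVals κ u i).min' h else 0

/-- The top point of the line lies in `κ`. [folklore] -/
theorem update_topT_mem {κ : Finset (Site d)} {u : Site d} (hu : u ∈ κ) (i : Fin d) :
    Function.update u i (topT κ u i) ∈ κ := by
  rw [topT, dif_pos (lineVals_nonempty hu i)]; exact mem_lineVals.1 (max'_mem _ _)

/-- The bottom point of the line lies in `κ`. [folklore] -/
theorem update_botT_mem {κ : Finset (Site d)} {u : Site d} (hu : u ∈ κ) (i : Fin d) :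
    Function.update u i (botT κ u i) ∈ κ := by
  rw [botT, dif_pos (lineVals_nonempty hu i)]; exact mem_lineVals.1 (min'_mem _ _)

/-- Maximality of `topT`. [folklore] -/
theorem le_topT {κ : Finset (Site d)} {u : Site d} {i : Fin d} {t : ℤ} (ht : Function.update u i t ∈ κ) :
    t ≤ topT κ u i := by
  have hne : (lineVals κ u i).Nonempty := ⟨t, mem_lineVals.2 ht⟩
  rw [topT, dif_pos hne]; exact le_max' _ _ (mem_lineVals.2 ht)

/-- Minimality of `botT`. [folklore] -/
theorem botT_le {κ : Finset (Site d)} {u : Site d} {i : Fin d} {t : ℤ} (ht : Function.update u i t ∈ κ) :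
    botT κ u i ≤ t := by
  have hne : (lineVals κ u i).Nonempty := ⟨t, mem_lineVals.2 ht⟩
  rw [botT, dif_pos hne]; exact min'_le _ _ (mem_lineVals.2 ht)

/-- **The top boundary pair** of the line through `u` in direction `i`: `(u[i ↦ T], u[i ↦ T+1])`.
[cite: VanenterFernandezSokal1993, App. B.5.3 (p. 239)] -/
def topPair (κ : Finset (Site d)) (u : Site d) (i : Fin d) : Site d × Site d :=
  (Function.update u i (topT κ u i), Function.update u i (topT κ u i + 1))

/-- **The bottom boundary pair** of the line through `u` in direction `i`: `(u[i ↦ T'], u[i ↦ T'-1])`.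
[cite: VanenterFernandezSokal1993, App. B.5.3 (p. 239)] -/
def botPair (κ : Finset (Site d)) (u : Site d) (i : Fin d) : Site d × Site d :=
  (Function.update u i (botT κ u i), Function.update u i (botT κ u i - 1))

/-- `u[i ↦ t+1] = u[i ↦ t] + eᵢ`. [folklore] -/
theorem update_succ_eq_add_single (u : Site d) (i : Fin d) (t : ℤ) :
    Function.update u i (t + 1) = Function.update u i t + Pi.single i 1 := by
  funext j
  by_cases hj : j = i
  · subst hj; simp
  · simp [Function.update_of_ne hj, Pi.single_eq_of_ne hj]

/-- Consecutive points of a lattice line are adjacent. [cite: FriedliVelenik2017, §3.1] -/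
theorem zdGraph_adj_update_succ (u : Site d) (i : Fin d) (t : ℤ) :
    (zdGraph d).Adj (Function.update u i t) (Function.update u i (t + 1)) :=
  (zdGraph_adj_iff _ _).2 ⟨i, Or.inl (update_succ_eq_add_single u i t)⟩

/-- Consecutive points of a lattice line are adjacent. [cite: FriedliVelenik2017, §3.1] -/
theorem zdGraph_adj_update_pred (u : Site d) (i : Fin d) (t : ℤ) :
    (zdGraph d).Adj (Function.update u i t) (Function.update u i (t - 1)) := by
  have h := zdGraph_adj_update_succ u i (t - 1)
  rw [sub_add_cancel] at h
  exact h.symm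

/-- On an image-free line through a point of `κ`, the top pair is a boundary pair of `κ`.
[cite: VanenterFernandezSokal1993, App. B.5.3 (p. 239)] -/
theorem topPair_mem_ffBdryPairs {κ : Finset (Site d)} {u : Site d} (hu : u ∈ κ) {i : Fin d}
    (hline : ∀ t, ¬ IsSpImageSite d b (Function.update u i t)) : topPair κ u i ∈ ffBdryPairs d b κ :=
  mem_ffBdryPairs.2 ⟨update_topT_mem hu i, fun h => by have := le_topT h; omega, hline _,
    zdGraph_adj_update_succ _ _ _⟩

/-- On an image-free line through a point of `κ`, the bottom pair is a boundary pair of `κ`.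
[cite: VanenterFernandezSokal1993, App. B.5.3 (p. 239)] -/
theorem botPair_mem_ffBdryPairs {κ : Finset (Site d)} {u : Site d} (hu : u ∈ κ) {i : Fin d}
    (hline : ∀ t, ¬ IsSpImageSite d b (Function.update u i t)) : botPair κ u i ∈ ffBdryPairs d b κ :=
  mem_ffBdryPairs.2 ⟨update_botT_mem hu i, fun h => by have := botT_le h; omega, hline _,
    zdGraph_adj_update_pred _ _ _⟩

/-- The top pair points in the direction `+eᵢ`. [folklore] -/
theorem topPair_snd_sub_fst (κ : Finset (Site d)) (u : Site d) (i : Fin d) :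
    (topPair κ u i).2 - (topPair κ u i).1 = Pi.single i 1 := by
  simp only [topPair]
  rw [update_succ_eq_add_single, add_sub_cancel_left]

/-- The bottom pair points in the direction `-eᵢ`. [folklore] -/
theorem botPair_fst_sub_snd (κ : Finset (Site d)) (u : Site d) (i : Fin d) :
    (botPair κ u i).1 - (botPair κ u i).2 = Pi.single i 1 := by
  simp only [botPair]
  have h := update_succ_eq_add_single u i (botT κ u i - 1)
  rw [sub_add_cancel] at h
  rw [h, add_sub_cancel_left]

/-- `eᵢ = eᵢ'` forces `i = i'`. [folklore] -/
theorem eq_of_single_eq_single {i i' : Fin d} (h : (Pi.single i (1 : ℤ) : Site d) = Pi.single i' 1) : i = i' := by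
  by_contra hne
  have := congrFun h i
  rw [Pi.single_eq_same, Pi.single_eq_of_ne hne] at this
  exact one_ne_zero this

/-- A top pair is never a bottom pair (their directions are opposite). [folklore] -/
theorem topPair_ne_botPair (κ κ' : Finset (Site d)) (u u' : Site d) (i i' : Fin d) :
    topPair κ u i ≠ botPair κ' u' i' := by
  intro h
  have h1 := topPair_snd_sub_fst κ u i
  have h2 := botPair_fst_sub_snd κ' u' i'
  rw [h] at h1
  have h3 : (Pi.single i (1 : ℤ) : Site d) + Pi.single i' 1 = 0 := by rw [← h1, ← h2]; abel
  have h4 := congrFun h3 i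
  by_cases hii : i = i'
  · subst hii
    simp only [Pi.add_apply, Pi.single_eq_same, Pi.zero_apply] at h4
    omega
  · rw [Pi.add_apply, Pi.single_eq_same, Pi.single_eq_of_ne hii, Pi.zero_apply] at h4
    omega

/-- Equal top pairs have the same direction and base lines. [folklore] -/
theorem topPair_eq_topPair {κ : Finset (Site d)} {u u' : Site d} {i i' : Fin d}
    (h : topPair κ u i = topPair κ u' i') : i = i' ∧ ∀ j, j ≠ i → u j = u' j := by
  have hdir : i = i' := by
    apply eq_of_single_eq_single
    rw [← topPair_snd_sub_fst κ u i, ← topPair_snd_sub_fst κ u' i', h]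
  subst hdir
  refine ⟨rfl, fun j hj => ?_⟩
  have h1 := congrFun (congrArg Prod.fst h) j
  simp only [topPair, Function.update_of_ne hj] at h1
  exact h1

/-- Equal bottom pairs have the same direction and base lines. [folklore] -/
theorem botPair_eq_botPair {κ : Finset (Site d)} {u u' : Site d} {i i' : Fin d}
    (h : botPair κ u i = botPair κ u' i') : i = i' ∧ ∀ j, j ≠ i → u j = u' j := by
  have hdir : i = i' := by
    apply eq_of_single_eq_single
    rw [← botPair_fst_sub_snd κ u i, ← botPair_fst_sub_snd κ u' i', h]
  subst hdir
  refine ⟨rfl, fun j hj => ?_⟩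
  have h1 := congrFun (congrArg Prod.fst h) j
  simp only [botPair, Function.update_of_ne hj] at h1
  exact h1

/-! #### Petals of the origin -/

/-- The coordinates of a neighbour `u = s eⱼ` of the origin. [cite: FriedliVelenik2017, §3.1] -/
theorem petal_apply_axisSign (hd : 2 ≤ d) {u : Site d} (hu : (zdGraph d).Adj 0 u) (k : Fin d) :
    u k = if k = (axisSign hd 0 u).1 then (axisSign hd 0 u).2 else 0 := by
  have h := (axisSign_spec hd hu).2
  conv_lhs => rw [h]
  rw [add_zsmul_single_apply, Pi.zero_apply, zero_add]

/-- The sign of a petal is nonzero. [folklore] -/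
theorem axisSign_snd_ne_zero (hd : 2 ≤ d) {u : Site d} (hu : (zdGraph d).Adj 0 u) : (axisSign hd 0 u).2 ≠ 0 := by
  rcases (axisSign_spec hd hu).1 with h | h <;> rw [h] <;> norm_num

/-- The sign of a petal has absolute value `1`. [folklore] -/
theorem abs_axisSign_snd (hd : 2 ≤ d) {u : Site d} (hu : (zdGraph d).Adj 0 u) : |(axisSign hd 0 u).2| = 1 := by
  rcases (axisSign_spec hd hu).1 with h | h <;> rw [h] <;> norm_num

/-- Two petals agreeing off a lateral coordinate of the first are equal. [folklore] -/
theorem petal_eq_of_forall_ne (hd : 2 ≤ d) {u u' : Site d} (hu : (zdGraph d).Adj 0 u) (hu' : (zdGraph d).Adj 0 u')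
    {i : Fin d} (hi : i ≠ (axisSign hd 0 u).1) (h : ∀ j, j ≠ i → u j = u' j) : u = u' := by
  set j := (axisSign hd 0 u).1 with hj
  have hjj := h j (Ne.symm hi)
  rw [petal_apply_axisSign hd hu j, if_pos rfl, petal_apply_axisSign hd hu' j] at hjj
  have hax : (axisSign hd 0 u').1 = j := by
    by_contra hne
    rw [if_neg (Ne.symm hne)] at hjj
    exact axisSign_snd_ne_zero hd hu hjj
  rw [if_pos hax.symm] at hjj
  funext k
  rw [petal_apply_axisSign hd hu k, petal_apply_axisSign hd hu' k, hax, ← hj, hjj]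

/-- **The lateral lines through a petal are image-free**: `u[i ↦ t]` has the coordinate `j ≠ i` of
`u = ±eⱼ` equal to `±1`. [cite: VanenterFernandezSokal1993, App. B.5.3 (p. 239)] -/
theorem not_isSpImageSite_update_petal (hd : 2 ≤ d) (hb : 2 ≤ b) {u : Site d} (hu : (zdGraph d).Adj 0 u)
    {i : Fin d} (hi : i ≠ (axisSign hd 0 u).1) (t : ℤ) : ¬ IsSpImageSite d b (Function.update u i t) := by
  intro himg
  have h := himg (axisSign hd 0 u).1
  rw [Function.update_of_ne (Ne.symm hi), petal_apply_axisSign hd hu, if_pos rfl] at h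
  exact not_dvd_of_abs_lt (axisSign_snd_ne_zero hd hu) (by rw [abs_axisSign_snd hd hu]; exact_mod_cast hb) h

/-! #### The injection -/

/-- The index set of the lateral boundary pairs: a petal `u ∈ κ`, a lateral direction `i ≠ j(u)` and
a side (top/bottom). [cite: VanenterFernandezSokal1993, App. B.5.3 (p. 239)] -/
def latIdx (hd : 2 ≤ d) (κ : Finset (Site d)) : Finset (Σ _ : Site d, Fin d × Bool) :=
  (κ ∩ (zdGraph d).neighborFinset 0).sigma fun u => (univ.erase (axisSign hd 0 u).1) ×ˢ (univ : Finset Bool)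

/-- `#latIdx = 2(d-1) · #petals`. [folklore] -/
theorem card_latIdx (hd : 2 ≤ d) (κ : Finset (Site d)) :
    #(latIdx hd κ) = #(κ ∩ (zdGraph d).neighborFinset 0) * ((d - 1) * 2) := by
  rw [latIdx, card_sigma, sum_const_nat]
  intro u _
  rw [card_product, card_erase_of_mem (mem_univ _), card_univ, Fintype.card_fin, card_univ, Fintype.card_bool]

/-- The lateral boundary pair of an index. [cite: VanenterFernandezSokal1993, App. B.5.3 (p. 239)] -/
def latPair (κ : Finset (Site d)) (x : Σ _ : Site d, Fin d × Bool) : Site d × Site d :=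
  if x.2.2 then topPair κ x.1 x.2.1 else botPair κ x.1 x.2.1

/-- Unpacking membership in `latIdx`. [folklore] -/
theorem mem_latIdx {hd : 2 ≤ d} {κ : Finset (Site d)} {x : Σ _ : Site d, Fin d × Bool} (hx : x ∈ latIdx hd κ) :
    x.1 ∈ κ ∧ (zdGraph d).Adj 0 x.1 ∧ x.2.1 ≠ (axisSign hd 0 x.1).1 := by
  obtain ⟨hu, hx2⟩ := mem_sigma.1 hx
  obtain ⟨huκ, hu0⟩ := mem_inter.1 hu
  exact ⟨huκ, (SimpleGraph.mem_neighborFinset _ _ _).1 hu0, (mem_erase.1 (mem_product.1 hx2).1).1⟩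

/-- Lateral pairs are boundary pairs. [cite: VanenterFernandezSokal1993, App. B.5.3 (p. 239)] -/
theorem latPair_mem_ffBdryPairs (hd : 2 ≤ d) (hb : 2 ≤ b) {κ : Finset (Site d)} {x : Σ _ : Site d, Fin d × Bool}
    (hx : x ∈ latIdx hd κ) : latPair κ x ∈ ffBdryPairs d b κ := by
  obtain ⟨huκ, hu0, hi⟩ := mem_latIdx hx
  unfold latPair
  split_ifs
  · exact topPair_mem_ffBdryPairs huκ (not_isSpImageSite_update_petal hd hb hu0 hi)
  · exact botPair_mem_ffBdryPairs huκ (not_isSpImageSite_update_petal hd hb hu0 hi)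

/-- **The lateral pairs are distinct.** [cite: VanenterFernandezSokal1993, App. B.5.3 (p. 239)] -/
theorem latPair_injOn (hd : 2 ≤ d) (κ : Finset (Site d)) : Set.InjOn (latPair κ) ↑(latIdx hd κ) := by
  rintro ⟨u, i, c⟩ hx ⟨u', i', c'⟩ hx' h
  obtain ⟨-, hu0, hi⟩ := mem_latIdx (mem_coe.1 hx)
  obtain ⟨-, hu0', hi'⟩ := mem_latIdx (mem_coe.1 hx')
  simp only [latPair] at h hi hi'
  cases c <;> cases c'
  · simp only [Bool.false_eq_true, if_false] at h
    obtain ⟨hii, hj⟩ := botPair_eq_botPair h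
    subst hii
    have := petal_eq_of_forall_ne hd hu0 hu0' hi hj
    subst this; rfl
  · simp only [Bool.false_eq_true, if_false, if_true] at h
    exact absurd h.symm (topPair_ne_botPair _ _ _ _ _ _)
  · simp only [Bool.false_eq_true, if_false, if_true] at h
    exact absurd h (topPair_ne_botPair _ _ _ _ _ _)
  · simp only [if_true] at h
    obtain ⟨hii, hj⟩ := topPair_eq_topPair h
    subst hii
    have := petal_eq_of_forall_ne hd hu0 hu0' hi hj
    subst this; rfl

/-- Hence `|∂κ|_ff ≥ 2(d-1) · #petals`. [cite: VanenterFernandezSokal1993, App. B.5.3 (p. 239)] -/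
theorem card_latIdx_le (hd : 2 ≤ d) (hb : 2 ≤ b) (κ : Finset (Site d)) :
    #(latIdx hd κ) ≤ #(ffBdryPairs d b κ) :=
  card_le_card_of_injOn (latPair κ) (fun _ hx => latPair_mem_ffBdryPairs hd hb hx) (latPair_injOn hd κ)

/-! #### One more boundary pair (`b ≥ 3`) -/

/-- **The extra boundary pair** attached to a petal `u₀ = s eⱼ ∈ κ`: the axial pair `(u₀, 2s eⱼ)` if
`2s eⱼ ∉ κ`, else the top pair of the (image-free, as `b ≥ 3`) lateral line through `2s eⱼ`.
[cite: VanenterFernandezSokal1993, App. B.5.3 (p. 239)] -/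
def extraPair (hd : 2 ≤ d) (κ : Finset (Site d)) (u₀ : Site d) : Site d × Site d :=
  if segPt hd 0 u₀ 2 ∈ κ then topPair κ (segPt hd 0 u₀ 2) (latAxis hd (axisSign hd 0 u₀).1)
  else (u₀, segPt hd 0 u₀ 2)

/-- The coordinates of `2s eⱼ`. [folklore] -/
theorem segPt_zero_two_apply (hd : 2 ≤ d) (u₀ : Site d) (k : Fin d) :
    segPt hd 0 u₀ 2 k = if k = (axisSign hd 0 u₀).1 then (axisSign hd 0 u₀).2 * 2 else 0 := by
  rw [segPt, add_zsmul_single_apply, Pi.zero_apply, zero_add]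

/-- The extra pair is a boundary pair (`b ≥ 3`). [cite: VanenterFernandezSokal1993, App. B.5.3 (p. 239)] -/
theorem extraPair_mem_ffBdryPairs (hd : 2 ≤ d) (hb : 3 ≤ b) {κ : Finset (Site d)} {u₀ : Site d} (hu₀ : u₀ ∈ κ)
    (h0 : (zdGraph d).Adj 0 u₀) : extraPair hd κ u₀ ∈ ffBdryPairs d b κ := by
  have h2b : |(2 : ℤ)| < b := by rw [abs_two]; exact_mod_cast hb
  unfold extraPair
  split_ifs with hmem
  · refine topPair_mem_ffBdryPairs hmem fun t himg => ?_
    have h := himg (axisSign hd 0 u₀).1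
    rw [Function.update_of_ne (latAxis_ne hd _).symm, segPt_zero_two_apply, if_pos rfl] at h
    exact not_dvd_sign_mul' (axisSign_spec hd h0).1 two_ne_zero h2b h
  · refine mem_ffBdryPairs.2 ⟨hu₀, hmem, not_isSpImageSite_segPt hd (isSpImageSite_zero b) h0 two_ne_zero h2b, ?_⟩
    have h := segPt_adj_succ hd h0 1
    rw [segPt_one hd h0] at h
    convert h using 2; norm_num

/-- **The extra pair is not a lateral pair.** [cite: VanenterFernandezSokal1993, App. B.5.3 (p. 239)] -/
theorem extraPair_not_mem_image (hd : 2 ≤ d) {κ : Finset (Site d)} {u₀ : Site d} (h0 : (zdGraph d).Adj 0 u₀) :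
    extraPair hd κ u₀ ∉ (latIdx hd κ).image (latPair κ) := by
  classical
  intro hmem
  obtain ⟨⟨u, i, c⟩, hx, hxe⟩ := mem_image.1 hmem
  obtain ⟨-, hu0, hi⟩ := mem_latIdx hx
  simp only at hi hu0
  set j := (axisSign hd 0 u₀).1 with hj
  set s := (axisSign hd 0 u₀).2 with hs
  have hs0 : s ≠ 0 := axisSign_snd_ne_zero hd h0
  have hs1 : |s| = 1 := abs_axisSign_snd hd h0
  have hsu : |(axisSign hd 0 u).2| = 1 := abs_axisSign_snd hd hu0
  unfold extraPair at hxe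
  split_ifs at hxe with hcase
  · -- the lateral line through `2s eⱼ`
    cases c
    · simp only [latPair, Bool.false_eq_true, if_false] at hxe
      exact topPair_ne_botPair _ _ _ _ _ _ hxe.symm
    · simp only [latPair, if_true] at hxe
      obtain ⟨hii, hline⟩ := topPair_eq_topPair hxe
      have h1 := hline j (by rw [hii]; exact (latAxis_ne hd j).symm)
      rw [segPt_zero_two_apply, if_pos hj, petal_apply_axisSign hd hu0] at h1
      split_ifs at h1 with hju
      · have : |(axisSign hd 0 u).2| = |s * 2| := by rw [h1]
        rw [hsu, abs_mul, hs1, abs_two] at this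
        norm_num at this
      · have : s * 2 = 0 := by rw [← h1]
        exact hs0 (by omega)
  · -- the axial pair `(u₀, 2s eⱼ)`
    have hfst : (latPair κ ⟨u, i, c⟩).1 = u₀ := by rw [hxe]
    have hsnd : (latPair κ ⟨u, i, c⟩).2 = segPt hd 0 u₀ 2 := by rw [hxe]
    -- the direction of the pair is `± eᵢ`, that of `(u₀, 2s eⱼ)` is `s eⱼ`: so `i = j`
    have hdiff : ∀ k, k ≠ j → (latPair κ ⟨u, i, c⟩).2 k = (latPair κ ⟨u, i, c⟩).1 k := by
      intro k hk
      rw [hfst, hsnd, segPt_zero_two_apply, if_neg hk, petal_apply_axisSign hd h0, if_neg hk]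
    have hij : i = j := by
      by_contra hne
      have h := hdiff i hne
      cases c
      · have h2 := congrFun (botPair_fst_sub_snd κ u i) i
        simp only [latPair, Bool.false_eq_true, if_false] at h h2
        rw [Pi.sub_apply, h, sub_self, Pi.single_eq_same] at h2
        exact zero_ne_one h2
      · have h2 := congrFun (topPair_snd_sub_fst κ u i) i
        simp only [latPair, if_true] at h h2
        rw [Pi.sub_apply, h, sub_self, Pi.single_eq_same] at h2
        exact zero_ne_one h2
    -- the first component lies on the line `u + ℤ eᵢ`, so agrees with `u` at the axis of `u`
    have hline : ∀ k, k ≠ i → (latPair κ ⟨u, i, c⟩).1 k = u k := by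
      intro k hk
      cases c
      · simp only [latPair, Bool.false_eq_true, if_false, botPair, Function.update_of_ne hk]
      · simp only [latPair, if_true, topPair, Function.update_of_ne hk]
    have h := hline (axisSign hd 0 u).1 (Ne.symm hi)
    rw [hfst, petal_apply_axisSign hd h0, petal_apply_axisSign hd hu0, if_pos rfl] at h
    rw [if_neg (by rw [← hj, ← hij]; exact Ne.symm hi)] at h
    exact axisSign_snd_ne_zero hd hu0 h.symm

/-- **The isoperimetric input of the near bound**: a finite set `κ ⊆ ℤ^d` containing `k ≥ 1` of the
`2d` neighbours of the origin has at least `2k(d-1) + 1` boundary pairs towards internal sites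
(`b ≥ 3`, `d ≥ 2`): both ends of the `d - 1` image-free lateral lines through each such neighbour,
and one more pair on the axis or on a lateral line at height `2`.
[cite: VanenterFernandezSokal1993, App. B.5.3 (p. 239)] -/
theorem card_ffBdryPairs_ge_of_petals (hd : 2 ≤ d) (hb : 3 ≤ b) (κ : Finset (Site d))
    (hk : (κ ∩ (zdGraph d).neighborFinset 0).Nonempty) :
    #(κ ∩ (zdGraph d).neighborFinset 0) * ((d - 1) * 2) + 1 ≤ #(ffBdryPairs d b κ) := by
  classical
  obtain ⟨u₀, hu₀⟩ := hk
  obtain ⟨hu₀κ, hu₀0⟩ := mem_inter.1 hu₀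
  have h0 : (zdGraph d).Adj 0 u₀ := (SimpleGraph.mem_neighborFinset _ _ _).1 hu₀0
  have hb2 : 2 ≤ b := by omega
  have hsub : insert (extraPair hd κ u₀) ((latIdx hd κ).image (latPair κ)) ⊆ ffBdryPairs d b κ := by
    intro x hx
    rcases mem_insert.1 hx with rfl | hx
    · exact extraPair_mem_ffBdryPairs hd hb hu₀κ h0
    · obtain ⟨y, hy, rfl⟩ := mem_image.1 hx
      exact latPair_mem_ffBdryPairs hd hb2 hy
  have h := card_le_card hsub
  rw [card_insert_of_notMem (extraPair_not_mem_image hd h0), card_image_of_injOn (latPair_injOn hd κ),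
    card_latIdx] at h
  exact h

end Lateral

/-! ### The `-` clusters of the petals and the near/far decomposition -/

section Near

variable {b : ℕ}

/-- A `-` path of `Λ` ends at a `-` site of `Λ`. [folklore] -/
theorem mem_and_eq_of_reflTransGen_minusRel {Λ : Finset (Site d)} {σ : SpinConfig (Site d)} {u x : Site d}
    (h : ReflTransGen (minusRel Λ σ) u x) (hu : u ∈ Λ ∧ σ u = -1) : x ∈ Λ ∧ σ x = -1 := by
  induction h with
  | refl => exact hu
  | tail _ hbc _ => exact hbc.2.2

/-- **The `-` clusters of the petals**: the sites of `Λ` joined to a `-` neighbour of the origin by a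
path of `-` spins of `Λ` (the union of the `-` clusters of `Λ` containing a neighbour of `0`).
[cite: VanenterFernandezSokal1993, §4.1.2 Step 3] -/
def negClus (Λ : Finset (Site d)) (σ : SpinConfig (Site d)) : Finset (Site d) :=
  open Classical in
  Λ.filter fun x => ∃ u, (zdGraph d).Adj 0 u ∧ u ∈ Λ ∧ σ u = -1 ∧ ReflTransGen (minusRel Λ σ) u x

/-- Membership in `negClus`. [folklore] -/
theorem mem_negClus {Λ : Finset (Site d)} {σ : SpinConfig (Site d)} {x : Site d} :
    x ∈ negClus Λ σ ↔ x ∈ Λ ∧ ∃ u, (zdGraph d).Adj 0 u ∧ u ∈ Λ ∧ σ u = -1 ∧ ReflTransGen (minusRel Λ σ) u x := by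
  classical
  unfold negClus
  convert mem_filter

/-- The cluster sites are `-`. [folklore] -/
theorem eq_neg_one_of_mem_negClus {Λ : Finset (Site d)} {σ : SpinConfig (Site d)} {x : Site d}
    (hx : x ∈ negClus Λ σ) : σ x = -1 := by
  obtain ⟨-, u, -, huΛ, hu, hch⟩ := mem_negClus.1 hx
  exact (mem_and_eq_of_reflTransGen_minusRel hch ⟨huΛ, hu⟩).2

/-- `negClus ⊆ Λ`. [folklore] -/
theorem negClus_subset (Λ : Finset (Site d)) (σ : SpinConfig (Site d)) : negClus Λ σ ⊆ Λ :=
  fun _ hx => (mem_negClus.1 hx).1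

/-- A petal in `Λ` belongs to the cluster set iff it is `-`. [folklore] -/
theorem petal_mem_negClus_iff {Λ : Finset (Site d)} {σ : SpinConfig (Site d)} {u : Site d}
    (hu0 : (zdGraph d).Adj 0 u) (huΛ : u ∈ Λ) : u ∈ negClus Λ σ ↔ σ u = -1 :=
  ⟨eq_neg_one_of_mem_negClus, fun h => mem_negClus.2 ⟨huΛ, u, hu0, huΛ, h, ReflTransGen.refl⟩⟩

/-- **The cluster set is an island**: its sites are `-`, and a site of `Λ` adjacent to it and not in
it is `+` (else it would be joined to the same petal). [cite: FriedliVelenik2017, Lemma 3.36] -/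
theorem isIsland_negClus (Λ : Finset (Site d)) (σ : SpinConfig (Site d)) : IsIsland Λ (negClus Λ σ) σ := by
  refine ⟨fun x hx => eq_neg_one_of_mem_negClus hx, fun z hzΛ hzK ⟨y, hy, hadj⟩ => ?_⟩
  rcases Int.units_eq_one_or (σ z) with h | h
  · exact h
  · exfalso
    obtain ⟨hyΛ, u, hu0, huΛ, hu, hch⟩ := mem_negClus.1 hy
    exact hzK (mem_negClus.2 ⟨hzΛ, u, hu0, huΛ, hu,
      hch.tail ⟨hadj, ⟨hyΛ, eq_neg_one_of_mem_negClus hy⟩, ⟨hzΛ, h⟩⟩⟩)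

/-- The cluster set depends only on the spins in `Λ`. [folklore] -/
theorem negClus_congr {Λ : Finset (Site d)} {σ σ' : SpinConfig (Site d)} (h : ∀ x ∈ Λ, σ x = σ' x) :
    negClus Λ σ = negClus Λ σ' := by
  have hrel : ∀ {σ σ' : SpinConfig (Site d)}, (∀ x ∈ Λ, σ x = σ' x) → ∀ a c, minusRel Λ σ a c → minusRel Λ σ' a c :=
    fun h a c ⟨hadj, ⟨ha, hσa⟩, ⟨hc, hσc⟩⟩ => ⟨hadj, ⟨ha, by rw [← h a ha]; exact hσa⟩, ⟨hc, by rw [← h c hc]; exact hσc⟩⟩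
  have hmono : ∀ {σ σ' : SpinConfig (Site d)}, (∀ x ∈ Λ, σ x = σ' x) → ∀ {u x : Site d},
      ReflTransGen (minusRel Λ σ) u x → ReflTransGen (minusRel Λ σ') u x := by
    intro σ σ' h u x hch
    induction hch with
    | refl => exact ReflTransGen.refl
    | tail _ hbc ih => exact ih.tail (hrel h _ _ hbc)
  have h' : ∀ x ∈ Λ, σ' x = σ x := fun x hx => (h x hx).symm
  ext x
  rw [mem_negClus, mem_negClus]
  constructor
  · rintro ⟨hx, u, hu0, huΛ, hu, hch⟩
    exact ⟨hx, u, hu0, huΛ, by rw [← h u huΛ]; exact hu, hmono h hch⟩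
  · rintro ⟨hx, u, hu0, huΛ, hu, hch⟩
    exact ⟨hx, u, hu0, huΛ, by rw [h u huΛ]; exact hu, hmono h' hch⟩

/-- A cluster site far from the origin witnesses the far event. [cite: VanenterFernandezSokal1993, §4.1.2 Step 3] -/
theorem farEvent_of_mem_negClus {Λ : Finset (Site d)} {σ : SpinConfig (Site d)} {x : Site d} {m : ℕ}
    (hx : x ∈ negClus Λ σ) (hm : m < supDist 0 x) : FarEvent Λ m σ := by
  obtain ⟨-, u, hu0, huΛ, hu, hch⟩ := mem_negClus.1 hx
  exact ⟨u, x, hu0, huΛ, hu, hm, hch⟩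

/-- The indicator of `{negClus = κ}`. [cite: VanenterFernandezSokal1993, §4.1.2 Step 3] -/
def clusInd (Λ κ : Finset (Site d)) (σ : SpinConfig (Site d)) : ℝ :=
  open Classical in if negClus Λ σ = κ then 1 else 0

/-- `clusInd ≥ 0`. [folklore] -/
theorem clusInd_nonneg (Λ κ : Finset (Site d)) (σ : SpinConfig (Site d)) : 0 ≤ clusInd Λ κ σ := by
  unfold clusInd; split_ifs <;> norm_num

/-- `clusInd ≤ 1`. [folklore] -/
theorem clusInd_le_one (Λ κ : Finset (Site d)) (σ : SpinConfig (Site d)) : clusInd Λ κ σ ≤ 1 := by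
  unfold clusInd; split_ifs <;> norm_num

/-- `{negClus = κ} ⊆ E_κ`. [cite: FriedliVelenik2017, Lemma 3.36] -/
theorem clusInd_le_islandInd (Λ κ : Finset (Site d)) (σ : SpinConfig (Site d)) : clusInd Λ κ σ ≤ islandInd Λ κ σ := by
  unfold clusInd islandInd
  by_cases h : negClus Λ σ = κ
  · rw [if_pos h, if_pos (h ▸ isIsland_negClus Λ σ)]
  · rw [if_neg h]; split_ifs <;> norm_num

/-- `clusInd` depends only on the spins in `Λ`. [folklore] -/
theorem clusInd_congr {Λ : Finset (Site d)} (κ : Finset (Site d)) {σ σ' : SpinConfig (Site d)}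
    (h : ∀ x ∈ Λ, σ x = σ' x) : clusInd Λ κ σ = clusInd Λ κ σ' := by
  unfold clusInd; rw [negClus_congr h]

/-- **The neighbour sum in terms of the `-` petals**: if all `2d` neighbours of the origin lie in `Λ`,
`S₀(σ) = 2d - 2 #{petals in negClus}`. [cite: VanenterFernandezSokal1993, §4.1.2 Step 3, eq. (4.7)] -/
theorem nbrSum_eq_of_petals {Λ : Finset (Site d)} (hΛpet : ∀ y, (zdGraph d).Adj 0 y → y ∈ Λ) (σ : SpinConfig (Site d)) :
    nbrSum (zdGraph d) Λ 0 σ = 2 * d - 2 * #(negClus Λ σ ∩ (zdGraph d).neighborFinset 0) := by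
  classical
  unfold nbrSum
  have hinter : Λ ∩ (zdGraph d).neighborFinset 0 = (zdGraph d).neighborFinset 0 :=
    inter_eq_right.2 fun y hy => hΛpet y ((SimpleGraph.mem_neighborFinset _ _ _).1 hy)
  rw [hinter]
  set P := (zdGraph d).neighborFinset 0 with hP
  have hM : negClus Λ σ ∩ P = P.filter fun y => σ y = -1 := by
    ext y
    rw [mem_inter, mem_filter]
    constructor
    · rintro ⟨hyK, hyP⟩; exact ⟨hyP, eq_neg_one_of_mem_negClus hyK⟩
    · rintro ⟨hyP, hy⟩
      have hy0 := (SimpleGraph.mem_neighborFinset _ _ _).1 hyP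
      exact ⟨(petal_mem_negClus_iff hy0 (hΛpet y hy0)).2 hy, hyP⟩
  rw [hM, ← sum_filter_add_sum_filter_not P (fun y => σ y = -1)]
  have h1 : ∑ y ∈ P.filter (fun y => σ y = -1), spinAt y σ = -(#(P.filter fun y => σ y = -1) : ℝ) := by
    rw [card_eq_sum_ones, Nat.cast_sum, Nat.cast_one, ← sum_neg_distrib]
    exact sum_congr rfl fun y hy => by simp [spinAt, (mem_filter.1 hy).2]
  have h2 : ∑ y ∈ P.filter (fun y => ¬ σ y = -1), spinAt y σ = (#(P.filter fun y => ¬ σ y = -1) : ℝ) := by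
    rw [card_eq_sum_ones, Nat.cast_sum, Nat.cast_one]
    refine sum_congr rfl fun y hy => ?_
    rcases Int.units_eq_one_or (σ y) with h | h
    · simp [spinAt, h]
    · exact absurd h (mem_filter.1 hy).2
  rw [h1, h2]
  have hcard := card_filter_add_card_filter_not (s := P) (fun y => σ y = -1)
  rw [hP, card_neighborFinset_zdGraph_holds] at hcard
  rw [hP]
  have : ((#(((zdGraph d).neighborFinset 0).filter fun y => ¬ σ y = -1) : ℕ) : ℝ) =
      2 * d - #(((zdGraph d).neighborFinset 0).filter fun y => σ y = -1) := by
    have h' : (#(((zdGraph d).neighborFinset 0).filter fun y => σ y = -1) : ℝ) +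
        #(((zdGraph d).neighborFinset 0).filter fun y => ¬ σ y = -1) = 2 * d := by exact_mod_cast hcard
    linarith
  rw [this]; ring

/-- At most `2d` petals. [folklore] -/
theorem card_inter_neighborFinset_le (κ : Finset (Site d)) : #(κ ∩ (zdGraph d).neighborFinset 0) ≤ 2 * d := by
  rw [← card_neighborFinset_zdGraph_holds (d := d) 0]
  exact card_le_card inter_subset_right

/-- **The pointwise near/far decomposition** of `exp(-2β S₀)`: with `K = negClus Λ σ` and
`k = #{petals in K}`, `exp(-2β S₀) = exp(4β(k - d))`; either `K` reaches sup-distance `> m` (the far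
event, and the left side is `≤ e^{4dβ}`), or `K ⊆ Λ ∩ box m` is one of the terms of the sum.
[cite: VanenterFernandezSokal1993, §4.1.2 Step 3] -/
theorem exp_nbrSum_le {Λ : Finset (Site d)} (hΛpet : ∀ y, (zdGraph d).Adj 0 y → y ∈ Λ) (m : ℕ) {β : ℝ} (hβ : 0 ≤ β) (σ : SpinConfig (Site d)) :
    Real.exp (-(2 * β) * nbrSum (zdGraph d) Λ 0 σ) ≤
      ∑ κ ∈ (Λ.filter fun x => x ∈ box d m).powerset,
          Real.exp (4 * β * (#(κ ∩ (zdGraph d).neighborFinset 0) - d)) * clusInd Λ κ σ +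
        Real.exp (4 * d * β) * farInd Λ m σ := by
  classical
  set K := negClus Λ σ with hK
  have hk := card_inter_neighborFinset_le (d := d) K
  have hkR : (#(K ∩ (zdGraph d).neighborFinset 0) : ℝ) ≤ 2 * d := by exact_mod_cast hk
  rw [nbrSum_eq_of_petals hΛpet σ, ← hK]
  have hsum0 : 0 ≤ ∑ κ ∈ (Λ.filter fun x => x ∈ box d m).powerset,
      Real.exp (4 * β * (#(κ ∩ (zdGraph d).neighborFinset 0) - d)) * clusInd Λ κ σ :=
    sum_nonneg fun κ _ => mul_nonneg (Real.exp_nonneg _) (clusInd_nonneg _ _ _)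
  by_cases hfar : ∃ x ∈ K, m < supDist 0 x
  · obtain ⟨x, hx, hm⟩ := hfar
    have hF : farInd Λ m σ = 1 := by
      unfold farInd; rw [if_pos (farEvent_of_mem_negClus hx hm)]
    rw [hF, mul_one]
    have : Real.exp (-(2 * β) * (2 * d - 2 * #(K ∩ (zdGraph d).neighborFinset 0))) ≤ Real.exp (4 * d * β) :=
      Real.exp_le_exp.2 (by nlinarith)
    linarith
  · push Not at hfar
    have hKmem : K ∈ (Λ.filter fun x => x ∈ box d m).powerset := by
      rw [mem_powerset]
      intro x hx
      exact mem_filter.2 ⟨negClus_subset Λ σ hx, mem_box_iff_supDist.2 (hfar x hx)⟩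
    have hterm : Real.exp (-(2 * β) * (2 * d - 2 * #(K ∩ (zdGraph d).neighborFinset 0))) =
        Real.exp (4 * β * (#(K ∩ (zdGraph d).neighborFinset 0) - d)) * clusInd Λ K σ := by
      have : clusInd Λ K σ = 1 := by unfold clusInd; rw [if_pos hK.symm]
      rw [this, mul_one]; congr 1; ring
    rw [hterm]
    have h1 := single_le_sum (f := fun κ => Real.exp (4 * β * (#(κ ∩ (zdGraph d).neighborFinset 0) - d)) * clusInd Λ κ σ)
      (fun κ _ => mul_nonneg (Real.exp_nonneg _) (clusInd_nonneg _ _ _)) hKmem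
    have h2 : 0 ≤ Real.exp (4 * d * β) * farInd Λ m σ := mul_nonneg (Real.exp_nonneg _) (farInd_nonneg _ _ _)
    linarith

/-- The arithmetic of the near bound: `4(k - d) - (2k(d-1) + 1) ≤ -1` for `1 ≤ k ≤ 2d`, `d ≥ 2`. [folklore] -/
theorem near_exponent_le {k : ℕ} (hd : 2 ≤ d) (hk : k ≤ 2 * d) :
    (4 : ℝ) * (k - d) - (k * ((d - 1 : ℕ) * 2 : ℕ) + 1 : ℕ) ≤ -1 := by
  have hd1 : ((d - 1 : ℕ) : ℝ) = d - 1 := by rw [Nat.cast_sub (by omega)]; simp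
  push_cast
  rw [hd1]
  have hkR : (k : ℝ) ≤ 2 * d := by exact_mod_cast hk
  have hdR : (2 : ℝ) ≤ d := by exact_mod_cast hd
  nlinarith

/-- **The near/far bound for `X = ⟨exp(-2β S₀)⟩`** in the internal volume `Λ^int_{R'}` (`R' ≥ 1`) with
the boundary condition `η_p` of `VEFS1993_plusPhase` (`d ≥ 2`, `b ≥ 3`, `β ≥ 0`):
`X ≤ 2^{#box m} e^{-β} + e^{4dβ} P(far event at scale m)` — each of the `≤ 2^{#box m}` possible cluster
sets `κ ∋` a petal costs `exp(4β(k-d)) exp(-β |∂κ|_ff) ≤ e^{-β}` by the flip bound and the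
isoperimetric input, the empty one `e^{-4dβ}`. [cite: VanenterFernandezSokal1993, §4.1.2 Step 3 and §4.3.1 Step 2] -/
theorem isingExpect_exp_nbrSum_le (hd : 2 ≤ d) (hb : 3 ≤ b) (p : ℤˣ) {R' : ℕ} (hR' : 1 ≤ R') {β : ℝ} (hβ : 0 ≤ β) (m : ℕ) :
    isingExpect (zdGraph d) (spacingIntVolume d b R') β 0 (.fixed (signedCoreAnnulusBC d b p R' R' 1 1))
        (fun σ => Real.exp (-(2 * β) * nbrSum (zdGraph d) (spacingIntVolume d b R') 0 σ)) ≤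
      (2 : ℝ) ^ #(box d m) * Real.exp (-β) +
        Real.exp (4 * d * β) * isingExpect (zdGraph d) (spacingIntVolume d b R') β 0
          (.fixed (signedCoreAnnulusBC d b p R' R' 1 1)) (farInd (spacingIntVolume d b R') m) := by
  classical
  set Λ := spacingIntVolume d b R' with hΛ
  set η := signedCoreAnnulusBC d b p R' R' 1 1 with hη
  set P := (Λ.filter fun x => x ∈ box d m).powerset with hP
  set c : Finset (Site d) → ℝ := fun κ => Real.exp (4 * β * (#(κ ∩ (zdGraph d).neighborFinset 0) - d)) with hc
  have hb2 : 2 ≤ b := by omega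
  have hΛpet : ∀ y, (zdGraph d).Adj 0 y → y ∈ Λ := fun y hy => mem_spacingIntVolume_of_adj_zero hb2 hR' hy
  have hΛint : ∀ u ∈ Λ, ¬ IsSpImageSite d b u := fun u hu => (mem_spacingIntVolume.1 hu).2
  have hη1 : ∀ z, z ∉ Λ → ¬ IsSpImageSite d b z → η z = 1 := fun z _ hz => signedCoreAnnulusBC_apply_internal p R' R' 1 1 hz
  have hηiso : MinusIsolated d b η := minusIsolated_signedCoreAnnulusBC (by omega) p R'
  -- measurability
  have hgm : Measurable fun σ : SpinConfig (Site d) => Real.exp (-(2 * β) * nbrSum (zdGraph d) Λ 0 σ) :=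
    Real.measurable_exp.comp ((measurable_nbrSum (zdGraph d) Λ 0).const_mul _)
  have hcm : ∀ κ, Measurable (clusInd (d := d) Λ κ) := fun κ =>
    DependsOn.measurable_of_finset Λ fun σ σ' h => clusInd_congr κ h
  have hfm : Measurable (farInd (d := d) Λ m) :=
    DependsOn.measurable_of_finset Λ fun σ σ' h => farInd_congr m h
  have hRm : Measurable fun σ : SpinConfig (Site d) => ∑ κ ∈ P, c κ * clusInd Λ κ σ + Real.exp (4 * d * β) * farInd Λ m σ :=
    (Finset.measurable_sum P fun κ _ => (hcm κ).const_mul _).add (hfm.const_mul _)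
  -- the pointwise bound, integrated
  have h1 := isingExpect_mono_fun (zdGraph d) Λ β 0 (.fixed η) hgm hRm fun σ => exp_nbrSum_le hΛpet m hβ σ
  refine h1.trans ?_
  rw [isingExpect_add' (zdGraph d) Λ 0 _ β (Finset.measurable_sum P fun κ _ => (hcm κ).const_mul _) (hfm.const_mul _),
    isingExpect_finset_sum' (zdGraph d) Λ 0 _ β P _ fun κ => (hcm κ).const_mul _,
    isingExpect_const_mul' (zdGraph d) Λ 0 _ β _ hfm]
  gcongr
  -- the near sum
  have hterm : ∀ κ ∈ P, isingExpect (zdGraph d) Λ β 0 (.fixed η) (fun σ => c κ * clusInd Λ κ σ) ≤ Real.exp (-β) := by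
    intro κ hκ
    rw [isingExpect_const_mul' (zdGraph d) Λ 0 _ β _ (hcm κ)]
    have hκΛ : κ ⊆ Λ := fun x hx => (mem_filter.1 (mem_powerset.1 hκ hx)).1
    have hE0 : 0 ≤ isingExpect (zdGraph d) Λ β 0 (.fixed η) (clusInd Λ κ) :=
      isingExpect_nonneg_of_nonneg _ _ _ _ _ (clusInd_nonneg Λ κ)
    have hE1 : isingExpect (zdGraph d) Λ β 0 (.fixed η) (clusInd Λ κ) ≤ 1 := by
      have := isingExpect_mono_fun (zdGraph d) Λ β 0 (.fixed η) (hcm κ) measurable_const (clusInd_le_one Λ κ)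
      rwa [isingExpect_const] at this
    have hEff : isingExpect (zdGraph d) Λ β 0 (.fixed η) (clusInd Λ κ) ≤ Real.exp (-(β * #(ffBdryPairs d b κ))) :=
      (isingExpect_mono_fun (zdGraph d) Λ β 0 (.fixed η) (hcm κ)
        (DependsOn.measurable_of_finset Λ fun σ σ' h => islandInd_congr hκΛ h) (clusInd_le_islandInd Λ κ)).trans
        (isingExpect_islandInd_le hd hb2 hκΛ hΛint hηiso hη1 hβ)
    have hk := card_inter_neighborFinset_le (d := d) κ
    have hdR : (1 : ℝ) ≤ d := by exact_mod_cast (show 1 ≤ d by omega)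
    by_cases hk0 : #(κ ∩ (zdGraph d).neighborFinset 0) = 0
    · -- no petal: `c κ = e^{-4dβ}`
      have hcκ : c κ ≤ Real.exp (-β) := by
        simp only [hc, hk0, Nat.cast_zero, zero_sub]
        exact Real.exp_le_exp.2 (by nlinarith)
      calc c κ * isingExpect (zdGraph d) Λ β 0 (.fixed η) (clusInd Λ κ) ≤ c κ * 1 := by gcongr
        _ ≤ Real.exp (-β) := by rw [mul_one]; exact hcκ
    · -- a petal: flip bound and the isoperimetric input
      have hne : (κ ∩ (zdGraph d).neighborFinset 0).Nonempty := card_pos.1 (Nat.pos_of_ne_zero hk0)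
      have hiso := card_ffBdryPairs_ge_of_petals hd hb κ hne
      have hisoR : ((#(κ ∩ (zdGraph d).neighborFinset 0) * ((d - 1) * 2) + 1 : ℕ) : ℝ) ≤ #(ffBdryPairs d b κ) := by
        exact_mod_cast hiso
      have hexp := near_exponent_le hd hk
      calc c κ * isingExpect (zdGraph d) Λ β 0 (.fixed η) (clusInd Λ κ)
          ≤ c κ * Real.exp (-(β * #(ffBdryPairs d b κ))) := by gcongr
        _ = Real.exp (4 * β * (#(κ ∩ (zdGraph d).neighborFinset 0) - d) + -(β * #(ffBdryPairs d b κ))) := by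
            rw [hc, Real.exp_add]
        _ ≤ Real.exp (-β) := Real.exp_le_exp.2 (by nlinarith)
  calc ∑ κ ∈ P, isingExpect (zdGraph d) Λ β 0 (.fixed η) (fun σ => c κ * clusInd Λ κ σ)
      ≤ ∑ κ ∈ P, Real.exp (-β) := sum_le_sum hterm
    _ = #P * Real.exp (-β) := by rw [sum_const, nsmul_eq_mul]
    _ ≤ (2 : ℝ) ^ #(box d m) * Real.exp (-β) := by
        gcongr
        rw [hP, card_powerset]
        have : #(Λ.filter fun x => x ∈ box d m) ≤ #(box d m) := card_le_card fun x hx => (mem_filter.1 hx).2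
        exact_mod_cast Nat.pow_le_pow_right (by norm_num) this

end Near

/-! ### The far bound with the torus side chosen, the unfixing of the origin, and the thresholds -/

section Assembly

variable {b : ℕ}

/-- **The far bound, torus side chosen**: `P^{η_p}_{Λ^int_{R'}}(far event at scale b(m'+2)) ≤ 15 (27^d ε_blk)^{m'+1}`
for the torus side `N = 2^{2R'+2m'+5}` (`isingExpect_farInd_le`, `sum_fam_le_contourSum`, `contourSum_le`).
[cite: FriedliVelenik2017, §10.4.2] [cite: VanenterFernandezSokal1993, §4.3.1 Step 2 and §4.3.2] -/
theorem isingExpect_farInd_le_pow (hd : 2 ≤ d) (hb : 2 ≤ b) (p : ℤˣ) {β : ℝ} (hβ : 0 ≤ β)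
    (hρ : (2 : ℝ) ^ (b ^ d) * Real.exp (-β / 4 ^ d) ≤ 1) (R' m' : ℕ)
    (hq : (27 : ℝ) ^ d * epsBlk d b β ≤ 1 / 2) (hsmall : 2 * ((2 * m' + 1) ^ d : ℕ) * epsBlk d b β ≤ 1 / 3) :
    isingExpect (zdGraph d) (spacingIntVolume d b R') β 0 (.fixed (signedCoreAnnulusBC d b p R' R' 1 1))
        (farInd (spacingIntVolume d b R') (b * (m' + 2))) ≤ 15 * ((27 : ℝ) ^ d * epsBlk d b β) ^ (m' + 1) := by
  set n : ℕ := 2 * R' + 2 * m' + 4 with hn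
  obtain ⟨N, hNn⟩ : ∃ N : ℕ, N = 2 ^ (n + 1) := ⟨_, rfl⟩
  have hlt : n + 1 < N := hNn ▸ Nat.lt_two_pow_self
  have hN3 : 3 ≤ N := by omega
  have hfit : 2 * R' + 2 * m' + 5 ≤ N := by omega
  have hmN : m' + 3 ≤ N := by omega
  haveI : NeZero N := ⟨by omega⟩
  haveI : NeZero (N * b) := ⟨(Nat.mul_pos (by omega) (by omega)).ne'⟩
  have hε := epsBlk_nonneg (d := d) (b := b) β
  have h1 := isingExpect_farInd_le hd hNn hN3 hb p hβ hρ R' m' m' hfit hsmall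
  have h2 := sum_fam_le_contourSum (d := d) (N := N) m' m' (cubeCenter d (by omega) R' m') hε
  have h3 := contourSum_le (d := d) hN3 m' hmN hε hq
  linarith

/-- `x ↦ (1 - x)/(1 + x)` is nonincreasing on `[0, ∞)`. [folklore] -/
theorem one_sub_div_one_add_anti {x y : ℝ} (hx : 0 ≤ x) (hxy : x ≤ y) : (1 - y) / (1 + y) ≤ (1 - x) / (1 + x) := by
  rw [div_le_div_iff₀ (by linarith) (by linarith)]
  nlinarith

/-- **Unfixing the origin** (§4.1.2 Step 3, the identity (4.10)–(4.11) with `h → +∞`, in the form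
`isingExpect_spinAt_insert_eq`, combined for `p = -1` with the FKG monotonicity in the boundary spin at
the origin): for `R' ≥ 1`, `⟨σ₀⟩^{η_p}_{W(R')} ≥ (1 - X)/(1 + X)` with
`X = ⟨exp(-2β S₀)⟩^{η_p}_{Λ^int_{R'}}`. [cite: VanenterFernandezSokal1993, §4.1.2 Step 3, eqs. (4.10)–(4.11)] -/
theorem spinAt_zero_ge_unfix (hb : 2 ≤ b) (p : ℤˣ) {R' : ℕ} (hR' : 1 ≤ R') {β : ℝ} (hβ : 0 ≤ β) :
    (1 - isingExpect (zdGraph d) (spacingIntVolume d b R') β 0 (.fixed (signedCoreAnnulusBC d b p R' R' 1 1))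
          (fun σ => Real.exp (-(2 * β) * nbrSum (zdGraph d) (spacingIntVolume d b R') 0 σ))) /
        (1 + isingExpect (zdGraph d) (spacingIntVolume d b R') β 0 (.fixed (signedCoreAnnulusBC d b p R' R' 1 1))
          (fun σ => Real.exp (-(2 * β) * nbrSum (zdGraph d) (spacingIntVolume d b R') 0 σ))) ≤
      isingExpect (zdGraph d) (spacingVolume d b R') β 0 (.fixed (signedCoreAnnulusBC d b p R' R' 1 1)) (spinAt 0) := by
  set Λ := spacingIntVolume d b R' with hΛ
  set η := signedCoreAnnulusBC d b p R' R' 1 1 with hη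
  set g : SpinConfig (Site d) → ℝ := fun σ => Real.exp (-(2 * β) * nbrSum (zdGraph d) Λ 0 σ) with hg
  rw [spacingVolume_eq_insert]
  have hz : (0 : Site d) ∉ Λ := zero_notMem_spacingIntVolume b R'
  have hN : ∀ y, (zdGraph d).Adj 0 y → y ∈ Λ := fun y hy => mem_spacingIntVolume_of_adj_zero hb hR' hy
  have hgm : Measurable g := Real.measurable_exp.comp ((measurable_nbrSum (zdGraph d) Λ 0).const_mul _)
  have hX0 : ∀ ζ : SpinConfig (Site d), 0 ≤ isingExpect (zdGraph d) Λ β 0 (.fixed ζ) g :=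
    fun ζ => isingExpect_nonneg_of_nonneg _ _ _ _ _ fun σ => Real.exp_nonneg _
  have hη0 : η 0 = p := signedCoreAnnulusBC_zero (by omega) p R' R' 1 1
  rcases Int.units_eq_one_or p with hp | hp
  · rw [hp] at hη0
    rw [isingExpect_spinAt_insert_eq (zdGraph d) hz hN β hη0]
  · -- `p = -1`: replace the (irrelevant) boundary spin at the origin by `+1`, then FKG
    set η' := Function.update η 0 1 with hη'
    have hcongr : isingExpect (zdGraph d) (insert 0 Λ) β 0 (.fixed η) (spinAt 0) =
        isingExpect (zdGraph d) (insert 0 Λ) β 0 (.fixed η') (spinAt 0) := by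
      refine isingExpect_fixed_congr_outerBoundary (zdGraph d) (fun y hy => ?_) β 0 (measurable_spinAt 0)
        (fun σ σ' h => by simp only [spinAt, h 0 (mem_insert_self _ _)])
      have hy0 : y ≠ 0 := fun h => (mem_outerBoundary_iff.1 hy).1 (h ▸ mem_insert_self _ _)
      rw [hη', Function.update_of_ne hy0]
    rw [hcongr, isingExpect_spinAt_insert_eq (zdGraph d) hz hN β (by rw [hη', Function.update_self])]
    -- `X(η') ≤ X(η)` since `η ≤ η'` and `g` is nonincreasing
    have hle : η ≤ η' := by
      intro y
      by_cases hy : y = 0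
      · subst hy; rw [hη', Function.update_self]; exact intUnits_le_one _
      · rw [hη', Function.update_of_ne hy]
    have hanti : Monotone fun σ => -g σ := by
      intro σ σ' hσ
      simp only [hg, neg_le_neg_iff]
      exact Real.exp_le_exp.2 (by nlinarith [nbrSum_mono (zdGraph d) Λ 0 hσ])
    have hmono := isingExpect_fixed_mono (zdGraph d) hβ Λ 0 hle hanti hgm.neg
    have hneg : ∀ ζ : SpinConfig (Site d), isingExpect (zdGraph d) Λ β 0 (.fixed ζ) (fun σ => -g σ) =
        -isingExpect (zdGraph d) Λ β 0 (.fixed ζ) g := by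
      intro ζ
      have := isingExpect_const_mul' (zdGraph d) Λ 0 (.fixed ζ) β (-1) hgm
      simp only [neg_one_mul] at this
      exact this
    rw [hneg, hneg, neg_le_neg_iff] at hmono
    exact one_sub_div_one_add_anti (hX0 η') hmono

/-- **The empty core (`R' = 0`)**: `⟨σ₀⟩^{η_p}_{W(0)} ≥ ⟨σ₀⟩^{η_p}_{W(1)}` — the boundary condition for
`R' = 0` dominates that for `R' = 1` (FKG in the boundary condition), and shrinking the volume from
`W(1)` to `W(0) = {0}` through `+` frozen spins increases `⟨σ₀⟩` (FKG in the volume).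
[cite: FriedliVelenik2017, Lemma 3.22 and Exercise 3.13] -/
theorem spinAt_zero_spacingVolume_one_le_zero (hb : 1 ≤ b) (p : ℤˣ) {β : ℝ} (hβ : 0 ≤ β) :
    isingExpect (zdGraph d) (spacingVolume d b 1) β 0 (.fixed (signedCoreAnnulusBC d b p 1 1 1 1)) (spinAt 0) ≤
      isingExpect (zdGraph d) (spacingVolume d b 0) β 0 (.fixed (signedCoreAnnulusBC d b p 0 0 1 1)) (spinAt 0) := by
  have hb0 : 0 < b := hb
  have hle : signedCoreAnnulusBC d b p 1 1 1 1 ≤ signedCoreAnnulusBC d b p 0 0 1 1 := by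
    intro y
    by_cases hy : y = 0
    · subst hy; rw [signedCoreAnnulusBC_zero hb0, signedCoreAnnulusBC_zero hb0]
    · rw [signedCoreAnnulusBC_zero_zero_of_ne hb0 p hy]; exact intUnits_le_one _
  have h1 := isingExpect_fixed_mono (zdGraph d) hβ (spacingVolume d b 1) 0 hle (spinAt_mono 0) (measurable_spinAt 0)
  have hsub : spacingVolume d b 0 ⊆ spacingVolume d b 1 := by
    intro y hy
    obtain ⟨hbox, h⟩ := mem_filter.1 hy
    exact mem_filter.2 ⟨box_mono d (by omega) hbox, h⟩
  have hplus : ∀ x ∈ spacingVolume d b 1 \ spacingVolume d b 0, signedCoreAnnulusBC d b p 0 0 1 1 x = 1 := by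
    intro x hx
    obtain ⟨-, hx0⟩ := mem_sdiff.1 hx
    exact signedCoreAnnulusBC_zero_zero_of_ne hb0 p fun h => hx0 (h ▸ zero_mem_spacingVolume b 0)
  have h2 := isingExpect_fixed_anti_volume (zdGraph d) hβ hsub 0 hplus (spinAt_mono 0) (measurable_spinAt 0)
  exact h1.trans h2

/-- An eventual bound `A φ(β) ≤ B` from `φ → 0` and `B > 0`. [folklore] -/
theorem eventually_mul_le {φ : ℝ → ℝ} (hφ : Filter.Tendsto φ Filter.atTop (nhds 0)) (A : ℝ) {B : ℝ} (hB : 0 < B) :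
    ∀ᶠ β in Filter.atTop, A * φ β ≤ B := by
  have h : Filter.Tendsto (fun β => A * φ β) Filter.atTop (nhds 0) := by simpa using hφ.const_mul A
  exact (h.eventually (Iic_mem_nhds hB)).mono fun β hβ => hβ

/-- `ε_blk → 0` as `β → ∞`. [folklore] -/
theorem tendsto_exp_neg_div : Filter.Tendsto (fun β : ℝ => Real.exp (-β / 4 ^ d)) Filter.atTop (nhds 0) := by
  have h : Filter.Tendsto (fun β : ℝ => -β / 4 ^ d) Filter.atTop Filter.atBot :=
    Filter.tendsto_neg_atTop_atBot.atBot_div_const (by positivity)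
  exact Real.tendsto_exp_atBot.comp h

/-- `ε_blk → 0` as `β → ∞`. [folklore] -/
theorem tendsto_epsBlk (d b : ℕ) : Filter.Tendsto (fun β : ℝ => epsBlk d b β) Filter.atTop (nhds 0) := by
  have h := ((tendsto_exp_neg_div (d := d)).const_mul ((2 : ℝ) ^ (b ^ d))).const_mul ((2 : ℝ) ^ d)
  simp only [mul_zero] at h
  exact h

/-- The far term is `C e^{-β}` when `m' + 1 = 4^d (4d + 1)`. [folklore] -/
theorem far_term_eq {m' : ℕ} (hm' : m' + 1 = 4 ^ d * (4 * d + 1)) (b : ℕ) (β : ℝ) :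
    Real.exp (4 * d * β) * (15 * ((27 : ℝ) ^ d * epsBlk d b β) ^ (m' + 1)) =
      15 * ((27 : ℝ) ^ d * (2 ^ d * 2 ^ (b ^ d))) ^ (m' + 1) * Real.exp (-β) := by
  have hpow : (Real.exp (-β / 4 ^ d)) ^ (m' + 1) = Real.exp (-((4 * d + 1) * β)) := by
    rw [← Real.exp_nat_mul]
    congr 1
    rw [hm']
    push_cast
    field_simp
  have hε : (27 : ℝ) ^ d * epsBlk d b β = (27 : ℝ) ^ d * (2 ^ d * 2 ^ (b ^ d)) * Real.exp (-β / 4 ^ d) := by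
    unfold epsBlk; ring
  rw [hε, mul_pow, hpow]
  have hexp : Real.exp (4 * d * β) * Real.exp (-((4 * d + 1) * β)) = Real.exp (-β) := by
    rw [← Real.exp_add]; congr 1; ring
  calc Real.exp (4 * d * β) * (15 * (((27 : ℝ) ^ d * (2 ^ d * 2 ^ (b ^ d))) ^ (m' + 1) * Real.exp (-((4 * d + 1) * β))))
      = 15 * ((27 : ℝ) ^ d * (2 ^ d * 2 ^ (b ^ d))) ^ (m' + 1) * (Real.exp (4 * d * β) * Real.exp (-((4 * d + 1) * β))) := by
        ring
    _ = _ := by rw [hexp]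

/-- **The thresholds**: all smallness conditions of the near and far bounds hold for `β` large.
[cite: VanenterFernandezSokal1993, §4.3.2] -/
theorem eventually_conditions (d b m' M : ℕ) (hm' : m' + 1 = 4 ^ d * (4 * d + 1)) :
    ∀ᶠ β : ℝ in Filter.atTop, 0 ≤ β ∧ (2 : ℝ) ^ (b ^ d) * Real.exp (-β / 4 ^ d) ≤ 1 ∧
      (27 : ℝ) ^ d * epsBlk d b β ≤ 1 / 2 ∧ 2 * ((2 * m' + 1) ^ d : ℕ) * epsBlk d b β ≤ 1 / 3 ∧
      (2 : ℝ) ^ M * Real.exp (-β) ≤ 1 / 6 ∧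
      Real.exp (4 * d * β) * (15 * ((27 : ℝ) ^ d * epsBlk d b β) ^ (m' + 1)) ≤ 1 / 6 := by
  have hexp1 : Filter.Tendsto (fun β : ℝ => Real.exp (-β)) Filter.atTop (nhds 0) :=
    Real.tendsto_exp_atBot.comp Filter.tendsto_neg_atTop_atBot
  have h0 : ∀ᶠ β : ℝ in Filter.atTop, 0 ≤ β := Filter.eventually_ge_atTop 0
  have h1 := eventually_mul_le (tendsto_exp_neg_div (d := d)) ((2 : ℝ) ^ (b ^ d)) one_pos
  have h2 := eventually_mul_le (tendsto_epsBlk d b) ((27 : ℝ) ^ d) (by norm_num : (0 : ℝ) < 1 / 2)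
  have h3 := eventually_mul_le (tendsto_epsBlk d b) (2 * ((2 * m' + 1) ^ d : ℕ)) (by norm_num : (0 : ℝ) < 1 / 3)
  have h4 := eventually_mul_le hexp1 ((2 : ℝ) ^ M) (by norm_num : (0 : ℝ) < 1 / 6)
  have h5 := eventually_mul_le hexp1 (15 * ((27 : ℝ) ^ d * (2 ^ d * 2 ^ (b ^ d))) ^ (m' + 1)) (by norm_num : (0 : ℝ) < 1 / 6)
  filter_upwards [h0, h1, h2, h3, h4, h5] with β hb0 hb1 hb2 hb3 hb4 hb5
  refine ⟨hb0, hb1, hb2, by linarith, hb4, ?_⟩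
  rw [far_term_eq hm']
  exact hb5

/-- **The `+` phase of the internal spins for `b ≥ 3`** (the remaining half of `VEFS1993_plusPhase`,
van Enter–Fernández–Sokal 1993, §4.3.2 informal Step 2 with §4.3.1 Step 2 — there via a "slight
generalisation" of Pirogov–Sinai theory, here by reflection positivity and a chessboard–Peierls
argument): for `d ≥ 2`, `b ≥ 3` there is `J₂ < ∞` such that for `β > J₂` the systems
`(spacingVolume d b R', β, 0, η_p)` satisfy `⟨σ₀⟩ ≥ 1/2` uniformly in `R'` and in the sign `p` of the
frozen origin. Proof: unfix the origin (`spinAt_zero_ge_unfix`); `X = ⟨e^{-2βS₀}⟩ ≤ 1/3` by the near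
bound (`isingExpect_exp_nbrSum_le`: cluster flips, Peierls condition App. B.5.3, lateral-line
isoperimetry) and the far bound (`isingExpect_farInd_le_pow`: chessboard estimate on the pinned torus,
DLR–FKG transfer); `R' = 0` by monotonicity. [cite: VanenterFernandezSokal1993, Theorem 4.3 and §4.3.2] -/
theorem plusPhase_three_le_rp : ∀ d b : ℕ, 2 ≤ d → 3 ≤ b → ∃ J₂ : ℝ, ∀ β : ℝ, J₂ < β → ∃ c : ℝ, 0 < c ∧
    ∀ p : ℤˣ, ∀ R' : ℕ, c ≤ isingExpect (zdGraph d) (spacingVolume d b R') β 0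
      (.fixed (signedCoreAnnulusBC d b p R' R' 1 1)) (spinAt 0) := by
  intro d b hd hb
  have hb2 : 2 ≤ b := by omega
  set m' : ℕ := 4 ^ d * (4 * d + 1) - 1 with hm'def
  have hm' : m' + 1 = 4 ^ d * (4 * d + 1) := by
    have : 1 ≤ 4 ^ d * (4 * d + 1) := Nat.mul_pos (by positivity) (by omega)
    omega
  set m : ℕ := b * (m' + 2) with hm
  obtain ⟨J, hJ⟩ := Filter.eventually_atTop.1 (eventually_conditions d b m' (#(box d m)) hm')
  refine ⟨J, fun β hβJ => ⟨1 / 2, by norm_num, fun p R' => ?_⟩⟩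
  obtain ⟨hβ0, hρ, hq, hsmall, hmid, hfar⟩ := hJ β hβJ.le
  have hmain : ∀ R', 1 ≤ R' → (1 : ℝ) / 2 ≤ isingExpect (zdGraph d) (spacingVolume d b R') β 0
      (.fixed (signedCoreAnnulusBC d b p R' R' 1 1)) (spinAt 0) := by
    intro R' hR'
    have hX := isingExpect_exp_nbrSum_le hd hb p hR' hβ0 m
    have hF := isingExpect_farInd_le_pow hd hb2 p hβ0 hρ R' m' hq hsmall
    have hun := spinAt_zero_ge_unfix (d := d) hb2 p hR' hβ0
    set X := isingExpect (zdGraph d) (spacingIntVolume d b R') β 0 (.fixed (signedCoreAnnulusBC d b p R' R' 1 1))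
      (fun σ => Real.exp (-(2 * β) * nbrSum (zdGraph d) (spacingIntVolume d b R') 0 σ)) with hXdef
    have hX0 : 0 ≤ X := isingExpect_nonneg_of_nonneg _ _ _ _ _ fun σ => Real.exp_nonneg _
    have hfar' : Real.exp (4 * d * β) * isingExpect (zdGraph d) (spacingIntVolume d b R') β 0
        (.fixed (signedCoreAnnulusBC d b p R' R' 1 1)) (farInd (spacingIntVolume d b R') m) ≤ 1 / 6 := by
      rw [hm]
      calc Real.exp (4 * d * β) * isingExpect (zdGraph d) (spacingIntVolume d b R') β 0
            (.fixed (signedCoreAnnulusBC d b p R' R' 1 1)) (farInd (spacingIntVolume d b R') (b * (m' + 2)))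
          ≤ Real.exp (4 * d * β) * (15 * ((27 : ℝ) ^ d * epsBlk d b β) ^ (m' + 1)) := by gcongr
        _ ≤ 1 / 6 := hfar
    have hX3 : X ≤ 1 / 3 := by linarith
    have hh : (1 : ℝ) / 2 ≤ (1 - X) / (1 + X) := by
      rw [div_le_div_iff₀ (by norm_num) (by linarith)]
      nlinarith
    exact hh.trans hun
  rcases Nat.eq_zero_or_pos R' with hR0 | hR'
  · rw [hR0]
    exact (hmain 1 le_rfl).trans (spinAt_zero_spacingVolume_one_le_zero (by omega) p hβ0)
  · exact hmain R' hR'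

/-- The RP/chessboard route discharges Theorem 4.3 as well (the tree's `VEFS1993_thm43_holds`,
`…Thm43Holds.lean`, applies the same reduction to the twisted-Peierls plus phase
`SpacingPeierls.plusPhase_three_le` of `…PlusPhaseProofs.lean`; this is the independent second proof).
[cite: VanenterFernandezSokal1993, Theorem 4.3] -/
example : VEFS1993_thm43 :=
  VEFS1993_thm43_of_plusPhase_three_le plusPhase_three_le_rp

end Assembly

end Literature.Barriers.CriticalPhenomena.NonGibbs

end
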